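import Summits.BirchSwinnertonDyer.BirchSwinnertonDyer.Theorems.KatoDescentTamePotSupersingularTameDefectIsogenyInvariance
import Summits.BirchSwinnertonDyer.BirchSwinnertonDyer.Theorems.KatoDescentTamePotSupersingularTameUpperReducibleLocalTorsion
import HarnessLib

/-!
# Route `KatoDescentTamePotSupersingular` (rung K8, sub-rung B4 (t′), cell `bsd-potss`): rational `p`-torsion on an
# additive potentially good class is READ OFF THE DEFECT `e` (this seat's WANTED W2) — no member of a (t′) class at
# `5` with `e = 3` has rational `5`-torsion —, so the reducible-defect node (item 19203) keeps only the rows at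
# `p = 3` and at `p = 5, e = 6`. ROUTE-FREE (imports NO `Theses.*` file; a `--supports … --as helper` file; seat
# `bsd-potss-k8t-c4` g5; nothing booked, BSD not proved by any of this)

THE POINT. Generation 5's `TameUpperReducibleLocalTorsion` emptied the torsion slack of crux M (Kato's member bound,
item 19196) on every (t′) class at `p ≥ 7` by Mazur's Step 1 at the additive prime; the case `p = 5`, `e = 3` was
true but needed the isogeny invariance of `e` on (t′) (sibling file `…TameDefectIsogenyInvariance`, W1). Here:

* §1 **W2 — torsion on the class read off `e`**: rational `p`-torsion on a member of an additive potentially good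
  class at `p ≥ 5` forces `(p = 5 ∧ e ∈ {4, 6}) ∨ (p = 7 ∧ e = 6)` (Kodaira II/III at `5`, II at `7`: b2b
  `not_dvd_torsionOrder_of_addv`, `padicValInt_minimalDiscriminantInt_of_padicValRat_c₄_eq_one`,
  `…_eq_two_of_padicValRat_c₆_eq_one`, and W1 to move `e` along the isogeny):
  **`not_dvd_torsionOrder_of_isIsogenous_of_semistabilityIndex`**; so `e = 3` (IV/IV*) and `e = 2` (I₀*) classes
  have NO member with rational `p`-torsion at any `p ≥ 5`, on (t′) at `5` (`e ∈ {3, 6}`) the `e = 3` classes are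
  `5`-torsion-free (`not_dvd_torsionOrder_of_isIsogenous_of_subTprime_five_of_ne_six`), and on a (t′) class at any
  `p ≥ 5` rational `p`-torsion forces `p = 5 ∧ e = 6` (`eq_five_and_semistabilityIndex_eq_six_of_dvd_torsionOrder_of_subTprime`).
* §2 **Item 19203's trust-base residue**: the upper half on every reducible (t′) rank-`0` row at `5` with `e ≠ 6`
  from M + Cassels + GZK + modularity ONLY (`upperReducible_of_katoMember_of_five_of_ne_six`, g4's
  `x3PotGoodRankZeroUpper_of_katoMember_of_classTorsionCoprime` with slack `0`), and the BODY of
  `TameUpperReducibleDefect` from M, Ogg–Saito, the CM triple, Cassels/GZK/modularity and the upper half on the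
  odd-parity reducible NON-CM (t′) rows at **`p = 3` or (`p = 5` and `e = 6`)** ONLY
  (`upperReducibleDefect_of_katoMember_of_oggSaito_of_hasCM_of_oddParityNonCM_three_or_fiveSix`). The item is
  meanwhile settled-by-citation through Kato's EXACT member count (`Kato2004.exists_memberHullCountInputs`, kmc
  p451821, glue 19712); this file is the TRUST-BASE REDUCTION: the rows above close from the weaker member bound M
  (`exists_memberHullInputs`) without the count fact. The `p = 5, e = 6` rows are genuinely outside the torsion
  road: `y² − 2xy − 3y = x³ − 3x²` (`N = 75`, Kodaira II at `5`) has `(0, 0)` of order `5`; at `p = 3` (`e = 4`,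
  III/III*) rational `3`-torsion occurs too.

§1 is unconditional; §2 is CONDITIONAL on its displayed hypotheses. Nothing asserted; NO item is closed.

References: [Mazur1977] Ch. III §5 Step 1 (p. 158); [SilvermanATAEC1994] IV Table 4.1 (PDF p. 365);
[SilvermanAEC2009] Cor. VII.7.2, VIII.8 Cor. 8.3; [Kato2004Asterisque] Thm. 12.6 (p. 222), Prop. 14.16 (2) (p. 244);
[Cassels1965ArithmeticVIII]; [BurungaleFlach2024] Thm. 1.1, Cor. 2; [Miller2011LMS] Def. 1.1.
-/

set_option autoImplicit false
-- the Theorems directory repeats the summit name (sibling precedent `KatoDescentPotSupersingularAssembly.lean`)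
set_option linter.dupNamespace false

noncomputable section

open scoped Classical

namespace Summit.BirchSwinnertonDyer.BirchSwinnertonDyer.Theorems.TameUpperReducibleTorsionByDefect

open WeierstrassCurve
  Literature.NumberTheory.EllipticCurves
  Literature.NumberTheory.EllipticCurves.Rank1Residual
  Literature.NumberTheory.EllipticCurves.Rank1Residual.Typed
  Summit.BirchSwinnertonDyer.Rank1Residual
  Summit.BirchSwinnertonDyer.Rank1Residual.Additive
  Summit.BirchSwinnertonDyer.Rank1Residual.O6
  Summit.BirchSwinnertonDyer.BirchSwinnertonDyer.Theorems.TameUpperReducibleMazurNodes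
  Summit.BirchSwinnertonDyer.BirchSwinnertonDyer.Theorems.TameUpperReducibleLocalTorsion
  Summit.BirchSwinnertonDyer.BirchSwinnertonDyer.Theorems.TameDefectIsogenyInvariance

/-! ## §1 W2: rational `p`-torsion on the class, read off the defect `e` (`p ≥ 5`) -/

section Torsion

variable {W W' : WeierstrassCurve ℚ} [W.IsElliptic] [W.IsGloballyMinimal] [W'.IsElliptic]
  {p : ℕ} [hp : Fact p.Prime]

/-- **Rational `p`-torsion somewhere in an additive potentially good class at `p ≥ 5` forces
`(p = 5 ∧ e ∈ {4, 6}) ∨ (p = 7 ∧ e = 6)`**, `e` the defect of ANY globally minimal member. Contrapositive form: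
if `p = 5 → e ∉ {4, 6}` and `p = 7 → e ≠ 6` then NO curve `ℚ`-isogenous to `W` has rational `p`-torsion. Proof: a
globally minimal model `C • W'` (*AEC* VIII.8.3, same torsion order) is additive potentially good at `p`
(`Addv.of_isIsogenous_of_padicValRat_j_nonneg`) with the SAME defect (W1, the sibling file's
`TameDefectIsogenyInvariance.semistabilityIndex_eq_of_isIsogenous`); rational `p`-torsion at an additive `p ≥ 5`
needs `v₅(c₄) = 1` (`⟹ v₅(Δ_min) ∈ {2, 3}`, `e ∈ {6, 4}`) or `v₇(c₆) = 1` (`⟹ v₇(Δ_min) = 2`, `e = 6`) —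
Mazur's Step 1 at the additive prime (b2b `not_dvd_torsionOrder_of_addv`,
`padicValInt_minimalDiscriminantInt_of_padicValRat_c₄_eq_one`, `…_eq_two_of_padicValRat_c₆_eq_one`).
UNCONDITIONAL. [cite: Mazur1977, Ch. III §5, Step 1, p. 158] [cite: SilvermanATAEC1994, IV Table 4.1 (PDF p. 365)]
[cite: SilvermanAEC2009, Cor. VII.7.2, VIII.8 Cor. 8.3] -/
theorem not_dvd_torsionOrder_of_isIsogenous_of_semistabilityIndex (hp5 : 5 ≤ p) (hadd : Addv W p)
    (hj : 0 ≤ padicValRat p W.j) (h : IsIsogenous W W')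
    (h5 : p = 5 → semistabilityIndex W p ≠ 4 ∧ semistabilityIndex W p ≠ 6)
    (h7 : p = 7 → semistabilityIndex W p ≠ 6) : ¬ p ∣ W'.torsionOrder := by
  obtain ⟨C, hC⟩ := hasGlobalMinimalModel_rat_holds W'
  haveI := hC
  have hiso : IsIsogenous W (C • W') := h.smul_right C
  obtain ⟨hadd', -⟩ := Addv.of_isIsogenous_of_padicValRat_j_nonneg (p := p) hadd hj hiso
  have he : semistabilityIndex (C • W') p = semistabilityIndex W p :=
    semistabilityIndex_eq_of_isIsogenous hp5 hj hiso
  -- the defect of the minimal member, read off `ord_p Δ_min`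
  have hofv : ∀ v : ℕ, padicValInt p (C • W').minimalDiscriminantInt = v →
      semistabilityIndex W p = 12 / Nat.gcd 12 v := by
    intro v hv
    rw [← he]
    unfold semistabilityIndex
    rw [hv]
  have hnd := not_dvd_torsionOrder_of_addv (C • W') p hp5 hadd'
    (fun hp5' h4 ↦ by
      obtain ⟨hne4, hne6⟩ := h5 hp5'
      rcases padicValInt_minimalDiscriminantInt_of_padicValRat_c₄_eq_one (C • W') p hp5 hadd' h4 with
        hv | hv
      · exact hne6 ((hofv 2 hv).trans (by decide))
      · exact hne4 ((hofv 3 hv).trans (by decide)))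
    (fun hp7 h6 ↦ h7 hp7 ((hofv 2
      (padicValInt_minimalDiscriminantInt_eq_two_of_padicValRat_c₆_eq_one (C • W') p hp5 hadd' h6)).trans
        (by decide)))
  rwa [show (C • W').torsionOrder = W'.torsionOrder from torsionOrder_variableChange_holds W' C] at hnd

/-- **An `e = 3` class (Kodaira IV / IV*) has NO member with rational `p`-torsion at any additive potentially good
`p ≥ 5`.** UNCONDITIONAL. [cite: Mazur1977, Ch. III §5, Step 1, p. 158] [cite: SilvermanATAEC1994, IV Table 4.1] -/
theorem not_dvd_torsionOrder_of_isIsogenous_of_semistabilityIndex_eq_three (hp5 : 5 ≤ p)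
    (hadd : Addv W p) (hj : 0 ≤ padicValRat p W.j) (he : semistabilityIndex W p = 3)
    (h : IsIsogenous W W') : ¬ p ∣ W'.torsionOrder :=
  not_dvd_torsionOrder_of_isIsogenous_of_semistabilityIndex hp5 hadd hj h (fun _ ↦ by omega)
    fun _ ↦ by omega

/-- **An `e = 2` class (Kodaira I₀*) has NO member with rational `p`-torsion at any additive `p ≥ 5`.**
UNCONDITIONAL. [cite: Mazur1977, Ch. III §5, Step 1, p. 158] [cite: SilvermanATAEC1994, IV Table 4.1] -/
theorem not_dvd_torsionOrder_of_isIsogenous_of_semistabilityIndex_eq_two (hp5 : 5 ≤ p)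
    (hadd : Addv W p) (hj : 0 ≤ padicValRat p W.j) (he : semistabilityIndex W p = 2)
    (h : IsIsogenous W W') : ¬ p ∣ W'.torsionOrder :=
  not_dvd_torsionOrder_of_isIsogenous_of_semistabilityIndex hp5 hadd hj h (fun _ ↦ by omega)
    fun _ ↦ by omega

/-- **On a (t′) row at `5` the defect is `3` or `6`** (`e ∈ {2, 3, 4, 6}` at an additive potentially good
`p ≥ 5`, and `e ∤ 4 = p − 1` excludes `2` and `4`). [cite: SilvermanATAEC1994, IV Table 4.1 (PDF p. 365)] -/
theorem semistabilityIndex_eq_three_or_six_of_subTprime_five (hp : p = 5) (hadd : Addv W p)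
    (hT : SubTprime W p) : semistabilityIndex W p = 3 ∨ semistabilityIndex W p = 6 := by
  subst hp
  have hnd := hT.2.2
  rcases semistabilityIndex_mem_of_addv W 5 le_rfl hadd (not_lt.mp hT.1) with he | he | he | he <;>
    rw [he] at hnd ⊢ <;> first | exact Or.inl rfl | exact Or.inr rfl | exact absurd (by decide) hnd

/-- **W2 at `5` — no curve `ℚ`-isogenous to a (t′) row at `5` with `e ≠ 6` (i.e. `e = 3`, Kodaira IV / IV*) has
rational `5`-torsion.** UNCONDITIONAL. The `e = 6` rows are genuinely different: `y² − 2xy − 3y = x³ − 3x²`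
(`N = 75`, II at `5`) has `(0, 0)` of order `5`. [cite: Mazur1977, Ch. III §5, Step 1, p. 158]
[cite: SilvermanATAEC1994, IV Table 4.1 (PDF p. 365)] -/
theorem not_dvd_torsionOrder_of_isIsogenous_of_subTprime_five_of_ne_six (hp : p = 5) (hadd : Addv W p)
    (hT : SubTprime W p) (h6 : semistabilityIndex W p ≠ 6) (h : IsIsogenous W W') :
    ¬ p ∣ W'.torsionOrder :=
  not_dvd_torsionOrder_of_isIsogenous_of_semistabilityIndex_eq_three (by omega) hadd (not_lt.mp hT.1)
    ((semistabilityIndex_eq_three_or_six_of_subTprime_five hp hadd hT).resolve_right h6) h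

/-- **On a (t′) class at `p ≥ 5`, rational `p`-torsion on some member forces `p = 5` and `e = 6`** — `p ≥ 7`:
none (`TameUpperReducibleLocalTorsion.not_dvd_torsionOrder_of_isIsogenous_of_subTprime_of_seven_le`); `p = 5`:
`e = 6` by the previous theorem. UNCONDITIONAL. [cite: Mazur1977, Ch. III §5, Step 1, p. 158] -/
theorem eq_five_and_semistabilityIndex_eq_six_of_dvd_torsionOrder_of_subTprime (hp5 : 5 ≤ p)
    (hadd : Addv W p) (hT : SubTprime W p) (h : IsIsogenous W W') (hdvd : p ∣ W'.torsionOrder) :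
    p = 5 ∧ semistabilityIndex W p = 6 := by
  by_cases h5 : p = 5
  · by_contra hne
    exact not_dvd_torsionOrder_of_isIsogenous_of_subTprime_five_of_ne_six h5 hadd hT
      (fun h6 ↦ hne ⟨h5, h6⟩) h hdvd
  · exact absurd hdvd (not_dvd_torsionOrder_of_isIsogenous_of_subTprime_of_seven_le
      (seven_le_of_prime_of_not_le_five hp.out (by omega)) hadd hT h)

end Torsion

/-! ## §2 Item 19203's trust-base residue: `p = 3`, or `p = 5` with `e = 6` -/

/-- **The upper half on EVERY reducible (t′) rank-`0` row at `5` with `e ≠ 6`**, granted crux M (`hK`), Cassels'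
isogeny invariance, GZK and modularity ONLY: no member of the class has rational `5`-torsion (§1), so Kato's
member bound has torsion slack `0` and transports to `W` by Cassels (g4's
`x3PotGoodRankZeroUpper_of_katoMember_of_classTorsionCoprime`). No parity, no `ℤ/p²`, no Cassels–Tate, no count
fact. Conditional on the displayed named facts; nothing asserted.
[cite: Kato2004Asterisque, Thm. 12.6 (p. 222), Prop. 14.16 (2) (p. 244)] [cite: Mazur1977, Ch. III §5, Step 1, p. 158]
[cite: Cassels1965ArithmeticVIII] [cite: Miller2011LMS, Def. 1.1] -/
theorem upperReducible_of_katoMember_of_five_of_ne_six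
    (hK : KatoMemberShaBoundOfReducible) (hCassels : bsdRHS_eq_of_isIsogenous)
    (hGZK : rank_eq_analyticRank_of_analyticRank_le_one) (hmod : hasEntireLFunction_rat)
    (W : WeierstrassCurve ℚ) [W.IsElliptic] [W.IsGloballyMinimal] (p : ℕ) [Fact p.Prime]
    (hp : p = 5) (hr : W.analyticRank = 0) (hadd : Addv W p) (hT : SubTprime W p)
    (h6 : semistabilityIndex W p ≠ 6) (hred : ¬ W.HasIrreducibleModPGaloisRep p) : MissingUpperBoundAt W p :=
  x3PotGoodRankZeroUpper_of_katoMember_of_classTorsionCoprime hK hCassels hGZK hmod W p (by omega) hadd.1 hadd.2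
    (not_lt.mp hT.1) hred hr fun _ _ hiso ↦
      not_dvd_torsionOrder_of_isIsogenous_of_subTprime_five_of_ne_six hp hadd hT h6 hiso

/-- An odd prime `p ≤ 5` is `3` or `5`. [folklore] -/
theorem eq_three_or_eq_five_of_prime_of_ne_two_of_le_five {p : ℕ} (hpp : p.Prime) (hp2 : p ≠ 2)
    (h5 : p ≤ 5) : p = 3 ∨ p = 5 := by
  interval_cases p <;> first | exact absurd hpp (by decide) | exact absurd rfl hp2 | simp

/-- **The BODY of `TameUpperReducibleDefect` (item 19203) from crux M, the Ogg–Saito schema, the CM triple,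
Cassels/GZK/modularity and the ODD-PARITY reducible NON-CM (t′) rows at `p = 3` OR (`p = 5` AND `e = 6`) ONLY.**
This seat's g5 `TameUpperReducibleLocalTorsion.upperReducibleDefect_of_katoMember_of_oggSaito_of_hasCM_of_oddParityNonCMLeFive`
with the `p = 5, e = 3` rows of its residue discharged by `upperReducible_of_katoMember_of_five_of_ne_six` (parity
unused there). The displayed residue `hres` — the upper half on the reducible non-CM (t′) rank-`0` rows with
`ord_p #Ш_an` odd at `p = 3`, or at `p = 5` with `e = 6` (Kodaira II / II*) — is the END of the torsion road:
rational `3`-torsion (III at `3`) and `5`-torsion (II at `5`, `N = 75`) do occur there. TRUST-BASE REDUCTION only: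
the item itself is settled-by-citation through Kato's exact member count (kmc p451821). Conditional; nothing
asserted; NO item is closed. [cite: Mazur1977, Ch. III §5, Step 1, p. 158]
[cite: Kato2004Asterisque, Thm. 12.6 (p. 222), Prop. 14.16 (2) (p. 244)] [cite: BurungaleFlach2024, Thm. 1.1 and Cor. 2]
[cite: SilvermanATAEC1994, Exercise 4.40 (PDF p. 380)] [cite: Cassels1965ArithmeticVIII] -/
theorem upperReducibleDefect_of_katoMember_of_oggSaito_of_hasCM_of_oddParityNonCM_three_or_fiveSix
    (hK : KatoMemberShaBoundOfReducible)
    (hOS : ∀ (V : WeierstrassCurve ℚ) (ℓ : ℕ) [Fact ℓ.Prime],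
      V.artinConductorExponent_tate_eq_conductorExponent_of_isElliptic ℓ)
    (hCM : bsdTriple_of_hasCM_of_L_one_ne_zero)
    (hCassels : bsdRHS_eq_of_isIsogenous) (hGZK : rank_eq_analyticRank_of_analyticRank_le_one)
    (hmod : hasEntireLFunction_rat)
    (hres : ∀ (W : WeierstrassCurve ℚ) [W.IsElliptic] [W.IsGloballyMinimal] (p : ℕ) [Fact p.Prime],
      (p = 3 ∨ (p = 5 ∧ semistabilityIndex W p = 6)) → W.analyticRank = 0 → Addv W p → SubTprime W p →
      ¬ W.HasIrreducibleModPGaloisRep p → ¬ W.HasCM → (∃ q : ℚ, shaAn W = (q : ℂ) ∧ ¬ Even (padicValRat p q)) →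
      MissingUpperBoundAt W p) :
    ∀ (W : WeierstrassCurve ℚ) [W.IsElliptic] [W.IsGloballyMinimal] (p : ℕ) [Fact p.Prime],
      W.analyticRank = 0 → p ≠ 2 → Addv W p → SubTprime W p → ¬ W.HasIrreducibleModPGaloisRep p →
      ¬ ((∀ (W' : WeierstrassCurve ℚ) [W'.IsElliptic], WeierstrassCurve.IsIsogenous W W' →
          ¬ p ^ 2 ∣ W'.torsionOrder) ∧
        ∀ q : ℚ, shaAn W = (q : ℂ) → Even (padicValRat p q)) →
      MissingUpperBoundAt W p :=
  upperReducibleDefect_of_katoMember_of_oggSaito_of_hasCM_of_oddParityNonCMLeFive hK hOS hCM hCassels hGZK hmod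
    fun W _ _ p _ h5 hr hp2 hadd hT hred hcm hodd ↦ by
      rcases eq_three_or_eq_five_of_prime_of_ne_two_of_le_five Fact.out hp2 h5 with hp3 | hp5
      · exact hres W p (Or.inl hp3) hr hadd hT hred hcm hodd
      · by_cases h6 : semistabilityIndex W p = 6
        · exact hres W p (Or.inr ⟨hp5, h6⟩) hr hadd hT hred hcm hodd
        · exact upperReducible_of_katoMember_of_five_of_ne_six hK hCassels hGZK hmod W p hp5 hr hadd hT h6 hred

end Summit.BirchSwinnertonDyer.BirchSwinnertonDyer.Theorems.TameUpperReducibleTorsionByDefect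

end
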